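import Mathlib
import Literature.Computability.AlgebraicComplexity.FastFourierTransform
import HarnessLib

/-!
# Schönhage–Strassen: the negative wrapped convolution in `R[x]` through `D = R[x]/(x^{2m}+1)`

Topic `Computability/AlgebraicComplexity`, continuing `FastFourierTransform.lean` (DFT/FFT,
`nconv`, `fastNconv_eq_nconv` over an arbitrary commutative ring).  This file proves the
correctness of **one level of GG Algorithm 8.20** (von zur Gathen–Gerhard, *Modern Computer
Algebra*, §8.3, "Fast negative wrapped convolution"; Thm 8.22, correctness part) at the level of
polynomials:

* `coeff_modByMonic_X_pow_add_one` — reduction modulo `x^d + 1` of a polynomial of degree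
  `< 2d` folds the upper half onto the lower half with a sign;
* `coeff_mul_modByMonic_eq_nconv` — **multiplication in `R[x]/(x^t+1)` is the negacyclic
  convolution `nconv t` of the coefficient sequences** (so the ring `D = R[x]/(x^{2m}+1)` of the
  algorithm multiplies by a negacyclic product of half size: the recursion of Algorithm 8.20);
* `block m f i = f_i` (the `i`-th block of `m` coefficients), `sum_block_mul_X_pow`
  (`f = ∑ f_i x^{mi}`), `ofSeq` (`f' = ∑ f_i y^i ∈ R[x][y]`);
* **`mul_modByMonic_eq_of_blocks`** (GG §8.3, eqs. (4)–(5)): for `deg f, deg g < n = mt`,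
  `fg mod (x^n+1) = (∑_{k<t} h_k x^{mk}) mod (x^n+1)` where `(h_k)_k = nconv t (f_i) (g_j)` is the
  negacyclic convolution over `R[x]` of the block sequences — proved as in the source: reduce
  `f'g'` modulo `y^t + 1` in `R[x][y]` and substitute `y ↦ x^m` (a ring homomorphism);
* **`mul_modByMonic_eq_of_blocks_adjoinRoot`** (GG §8.3, eq. (6)): the same with the `h_k`
  computed in `D = AdjoinRoot (x^{2m}+1)` and lifted back (`deg h_k ≤ 2m − 2`, "nothing happens");
* **`mul_modByMonic_eq_schonhageStep`** (Algorithm 8.20, steps 2–4): with `t = 2^κ ∣ 2m`,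
  `η = x^{2m/t} mod (x^{2m}+1)` (so `η^t = −1`) and `2` a unit, the `h_k` are given by the
  three-FFT formula `fastNconv κ η t⁻¹` of `FastFourierTransform.lean`, whose only
  multiplications in `D` are the `t` pointwise products.

Operation counts and the recursion on coefficient vectors are not in this file.

## References

* J. von zur Gathen, J. Gerhard, *Modern Computer Algebra*, CUP (1st ed. 1999, 3rd ed. 2013),
  §8.3, Algorithm 8.20 and Theorem 8.22 (text checked on the internal scan
  panama:448136887664644). [GathenGerhard2013]
* A. Schönhage, V. Strassen, *Schnelle Multiplikation großer Zahlen*, Computing 7 (1971)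
  281–292. [SchonhageStrassen1971]
* D. Harvey, Math. Comp. 90 (2021), §2.2, Lemma 2.1 (`M_N(d)`; consumer). [Harvey2021]
-/

namespace Literature.Computability.AlgebraicComplexity

open _root_.Finset _root_.Polynomial

variable {R : Type*} [CommRing R]

/-! ### Reduction modulo `x^d + 1` -/

/-- `x^d + 1` is monic for `d > 0`. [folklore] -/
theorem monic_X_pow_add_one {d : ℕ} (hd : 0 < d) : (X ^ d + 1 : R[X]).Monic := by
  simpa using monic_X_pow_add_C (1 : R) hd.ne'

/-- `x^d + 1` has degree `d`. [folklore] -/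
theorem natDegree_X_pow_add_one {d : ℕ} [Nontrivial R] : (X ^ d + 1 : R[X]).natDegree = d := by
  simpa using natDegree_X_pow_add_C (n := d) (r := (1 : R))

/-- **Folding modulo `x^d + 1`**: if `deg P < 2d` then, for `k < d`,
`(P mod (x^d+1))_k = P_k − P_{k+d}`. [folklore] -/
theorem coeff_modByMonic_X_pow_add_one {d : ℕ} (hd : 0 < d) {P : R[X]}
    (hP : P.natDegree < 2 * d) {k : ℕ} (hk : k < d) :
    (P %ₘ (X ^ d + 1)).coeff k = P.coeff k - P.coeff (k + d) := by
  nontriviality R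
  set G : R[X] := X ^ d + 1 with hG
  have hmon : G.Monic := monic_X_pow_add_one hd
  have hGdeg : G.natDegree = d := natDegree_X_pow_add_one
  have hG1 : G ≠ 1 := by
    intro h
    have := congrArg natDegree h
    rw [hGdeg, natDegree_one] at this
    omega
  set q := P /ₘ G with hq
  set r := P %ₘ G with hr
  have hdec : r + G * q = P := modByMonic_add_div P G
  have hqdeg : q.natDegree < d := by
    rw [hq, natDegree_divByMonic P hmon, hGdeg]; omega
  have hrdeg : r.natDegree < d := by
    have := natDegree_modByMonic_lt P hmon hG1
    rwa [hGdeg] at this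
  have hGq : ∀ e, (G * q).coeff e = (if d ≤ e then q.coeff (e - d) else 0) + q.coeff e := by
    intro e
    rw [hG, add_mul, one_mul, coeff_add, coeff_X_pow_mul']
  have h1 : P.coeff k = r.coeff k + q.coeff k := by
    rw [← hdec, coeff_add, hGq, if_neg (by omega), zero_add]
  have h2 : P.coeff (k + d) = q.coeff k := by
    rw [← hdec, coeff_add, hGq, if_pos (by omega), Nat.add_sub_cancel,
      coeff_eq_zero_of_natDegree_lt (by omega : r.natDegree < k + d),
      coeff_eq_zero_of_natDegree_lt (by omega : q.natDegree < k + d)]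
    ring
  rw [h1, h2]; ring

/-- **Multiplication modulo `x^t + 1` is the negacyclic convolution of the coefficient
sequences**: for `deg p, deg q < t` and `k < t`, `((p·q) mod (x^t+1))_k = nconv t p q k`.
(In particular the ring `D = R[x]/(x^{2m}+1)` of GG Algorithm 8.20 multiplies by a negative
wrapped convolution of length `2m` — the recursive call.) [cite: GathenGerhard2013, §8.3 (negative wrapped convolution)] -/
theorem coeff_mul_modByMonic_eq_nconv {t : ℕ} (ht : 0 < t) {p q : R[X]}
    (hp : p.natDegree < t) (hq : q.natDegree < t) {k : ℕ} (hk : k < t) :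
    ((p * q) %ₘ (X ^ t + 1)).coeff k = nconv t (fun i => p.coeff i) (fun i => q.coeff i) k := by
  have hpq : (p * q).natDegree < 2 * t := by
    have := natDegree_mul_le (p := p) (q := q); omega
  rw [coeff_modByMonic_X_pow_add_one ht hpq hk, coeff_mul, coeff_mul,
    Nat.sum_antidiagonal_eq_sum_range_succ (fun i j => p.coeff i * q.coeff j) k,
    Nat.sum_antidiagonal_eq_sum_range_succ (fun i j => p.coeff i * q.coeff j) (k + t), nconv]
  congr 1
  -- the upper antidiagonal only meets the square `[0,t)²` in `k < i < t`
  rw [← sum_range_add_sum_Ico _ (show t ≤ k + t + 1 by omega),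
    ← sum_range_add_sum_Ico _ (show k + 1 ≤ t from hk)]
  have h0 : ∑ i ∈ range (k + 1), p.coeff i * q.coeff (k + t - i) = 0 := by
    refine sum_eq_zero fun i hi => ?_
    have := mem_range.1 hi
    rw [coeff_eq_zero_of_natDegree_lt (by omega : q.natDegree < k + t - i), mul_zero]
  have h2 : ∑ i ∈ Ico t (k + t + 1), p.coeff i * q.coeff (k + t - i) = 0 := by
    refine sum_eq_zero fun i hi => ?_
    have := (mem_Ico.1 hi).1
    rw [coeff_eq_zero_of_natDegree_lt (by omega : p.natDegree < i), zero_mul]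
  rw [h0, h2, zero_add, add_zero]

/-! ### Blocks and the bivariate lift -/

/-- The `i`-th **block** of `m` coefficients of `f`, as a polynomial of degree `< m`:
`f_i = ∑_{l<m} f_{mi+l} x^l` (GG §8.3: `f = ∑ f_i x^{mi}`). [cite: GathenGerhard2013, §8.3 Algorithm 8.20 step 2] -/
noncomputable def block (m : ℕ) (f : R[X]) (i : ℕ) : R[X] :=
  ∑ l ∈ range m, C (f.coeff (m * i + l)) * X ^ l

/-- Coefficients of a block. [folklore] -/
theorem coeff_block (m : ℕ) (f : R[X]) (i l : ℕ) :
    (block m f i).coeff l = if l < m then f.coeff (m * i + l) else 0 := by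
  simp [block, coeff_X_pow]

/-- A block has degree `< m`. [folklore] -/
theorem natDegree_block_lt {m : ℕ} (hm : 0 < m) (f : R[X]) (i : ℕ) :
    (block m f i).natDegree < m := by
  have : (block m f i).natDegree ≤ m - 1 :=
    natDegree_sum_le_of_forall_le _ _ fun l hl =>
      (natDegree_C_mul_X_pow_le _ _).trans (by have := mem_range.1 hl; omega)
  omega

/-- **Block decomposition**: `f = ∑_{i<t} f_i · x^{mi}` when `deg f < mt`. [cite: GathenGerhard2013, §8.3 Algorithm 8.20 step 2] -/
theorem sum_block_mul_X_pow {m t : ℕ} {f : R[X]} (hf : f.natDegree < m * t) :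
    ∑ i ∈ range t, block m f i * X ^ (m * i) = f := by
  have h1 : ∀ i ∈ range t, block m f i * X ^ (m * i) =
      ∑ l ∈ range m, C (f.coeff (m * i + l)) * X ^ (m * i + l) := by
    intro i _
    rw [block, sum_mul]
    refine sum_congr rfl fun l _ => ?_
    rw [mul_assoc, ← pow_add, Nat.add_comm l]
  rw [sum_congr rfl h1, ← sum_range_mul_eq_sum_sum m (fun e => C (f.coeff e) * X ^ e) t]
  conv_rhs => rw [as_sum_range' f (m * t) hf]
  refine sum_congr rfl fun e _ => ?_
  rw [C_mul_X_pow_eq_monomial]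

/-- The polynomial with a given coefficient sequence on `range t`:
`ofSeq t F = ∑_{i<t} F_i y^i` (for `F_i ∈ R[x]` this is `f' ∈ R[x][y]` of GG §8.3). [folklore] -/
noncomputable def ofSeq {S : Type*} [CommRing S] (t : ℕ) (F : ℕ → S) : S[X] :=
  ∑ i ∈ range t, C (F i) * X ^ i

/-- Coefficients of `ofSeq`. [folklore] -/
theorem coeff_ofSeq {S : Type*} [CommRing S] (t : ℕ) (F : ℕ → S) (i : ℕ) :
    (ofSeq t F).coeff i = if i < t then F i else 0 := by
  simp [ofSeq, coeff_X_pow]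

/-- `ofSeq t F` has degree `< t` (for `t > 0`). [folklore] -/
theorem natDegree_ofSeq_lt {S : Type*} [CommRing S] {t : ℕ} (ht : 0 < t) (F : ℕ → S) :
    (ofSeq t F).natDegree < t := by
  have : (ofSeq t F).natDegree ≤ t - 1 :=
    natDegree_sum_le_of_forall_le _ _ fun l hl =>
      (natDegree_C_mul_X_pow_le _ _).trans (by have := mem_range.1 hl; omega)
  omega

/-- Evaluating `ofSeq t F` at `x`: `∑_{i<t} F_i x^i`. [folklore] -/
theorem eval_ofSeq {S : Type*} [CommRing S] (t : ℕ) (F : ℕ → S) (x : S) :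
    (ofSeq t F).eval x = ∑ i ∈ range t, F i * x ^ i := by
  simp [ofSeq, eval_finsetSum]

/-- A polynomial of degree `< t` is `ofSeq` of its coefficients. [folklore] -/
theorem ofSeq_coeff_eq {S : Type*} [CommRing S] {t : ℕ} {p : S[X]} (hp : p.natDegree < t) :
    ofSeq t (fun i => p.coeff i) = p := by
  rw [ofSeq]
  conv_rhs => rw [as_sum_range' p t hp]
  refine sum_congr rfl fun e _ => ?_
  rw [C_mul_X_pow_eq_monomial]

/-! ### One level of Algorithm 8.20 -/

/-- **GG §8.3, eqs. (4)–(5): splitting the negacyclic product into blocks.**  For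
`deg f, deg g < n = mt` (`m, t > 0`),
`fg mod (x^n+1) = (∑_{k<t} h_k x^{mk}) mod (x^n+1)` with `h = nconv t (f_i)_i (g_j)_j`, the
negacyclic convolution over `R[x]` of the block sequences.  Proof as printed: in `R[x][y]`,
`f'g' = h' + (y^t+1)q'` with `h' = f'g' mod (y^t+1)`, whose coefficients are the `h_k`
(`coeff_mul_modByMonic_eq_nconv`); substituting `y ↦ x^m` (the ring homomorphism `eval (x^m)`)
gives `fg = ∑ h_k x^{mk} + (x^n+1)·q'(x, x^m)`. [cite: GathenGerhard2013, §8.3 eqs. (4)–(5)] -/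
theorem mul_modByMonic_eq_of_blocks {m t : ℕ} (hm : 0 < m) (ht : 0 < t) {f g : R[X]}
    (hf : f.natDegree < m * t) (hg : g.natDegree < m * t) :
    (f * g) %ₘ (X ^ (m * t) + 1) =
      (∑ k ∈ range t, nconv t (block m f) (block m g) k * X ^ (m * k)) %ₘ (X ^ (m * t) + 1) := by
  nontriviality R
  -- the bivariate lifts `f'`, `g'` and the reduction `h'` of their product modulo `y^t + 1`
  obtain ⟨F, hF⟩ : ∃ F : Polynomial R[X], F = ofSeq t (block m f) := ⟨_, rfl⟩
  obtain ⟨G, hG⟩ : ∃ G : Polynomial R[X], G = ofSeq t (block m g) := ⟨_, rfl⟩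
  have hmon : (X ^ t + 1 : Polynomial R[X]).Monic := monic_X_pow_add_one ht
  have hFdeg : F.natDegree < t := hF ▸ natDegree_ofSeq_lt ht _
  have hGdeg : G.natDegree < t := hG ▸ natDegree_ofSeq_lt ht _
  obtain ⟨H, hH⟩ : ∃ H : Polynomial R[X], H = (F * G) %ₘ (X ^ t + 1) := ⟨_, rfl⟩
  obtain ⟨Q, hQ⟩ : ∃ Q : Polynomial R[X], Q = (F * G) /ₘ (X ^ t + 1) := ⟨_, rfl⟩
  have hHdeg : H.natDegree < t := by
    have hY1 : (X ^ t + 1 : Polynomial R[X]) ≠ 1 := by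
      intro h
      have := congrArg natDegree h
      rw [natDegree_X_pow_add_one, natDegree_one] at this
      omega
    have := natDegree_modByMonic_lt (F * G) hmon hY1
    rwa [natDegree_X_pow_add_one, ← hH] at this
  -- coefficients of `h'` are the negacyclic convolution of the blocks
  have hHcoeff : ∀ k < t, H.coeff k = nconv t (block m f) (block m g) k := by
    intro k hk
    rw [hH, coeff_mul_modByMonic_eq_nconv ht hFdeg hGdeg hk]
    refine nconv_congr (fun i hi => ?_) (fun i hi => ?_) hk
    · rw [hF, coeff_ofSeq, if_pos hi]
    · rw [hG, coeff_ofSeq, if_pos hi]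
  -- substitute `y ↦ x^m`
  have hdec : H + (X ^ t + 1) * Q = F * G := by
    rw [hH, hQ]; exact modByMonic_add_div _ _
  have heval := congrArg (eval (X ^ m : R[X])) hdec
  rw [eval_add, eval_mul, eval_mul] at heval
  have hFe : F.eval (X ^ m) = f := by
    rw [hF, eval_ofSeq]
    conv_rhs => rw [← sum_block_mul_X_pow hf]
    refine sum_congr rfl fun i _ => ?_
    rw [← pow_mul]
  have hGe : G.eval (X ^ m) = g := by
    rw [hG, eval_ofSeq]
    conv_rhs => rw [← sum_block_mul_X_pow hg]
    refine sum_congr rfl fun i _ => ?_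
    rw [← pow_mul]
  have hYe : (X ^ t + 1 : Polynomial R[X]).eval (X ^ m) = X ^ (m * t) + 1 := by
    rw [eval_add, eval_pow, eval_X, eval_one, ← pow_mul]
  have hHe : H.eval (X ^ m) = ∑ k ∈ range t, nconv t (block m f) (block m g) k * X ^ (m * k) := by
    rw [← ofSeq_coeff_eq hHdeg, eval_ofSeq]
    refine sum_congr rfl fun k hk => ?_
    rw [hHcoeff k (mem_range.1 hk), ← pow_mul]
  rw [hFe, hGe, hYe, hHe] at heval
  -- `fg = ∑ h_k x^{mk} + (x^n+1)·q` gives equal residues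
  have hmon' : (X ^ (m * t) + 1 : R[X]).Monic := monic_X_pow_add_one (Nat.mul_pos hm ht)
  have hzero : ((X ^ (m * t) + 1) * Q.eval (X ^ m)) %ₘ (X ^ (m * t) + 1) = 0 :=
    (modByMonic_eq_zero_iff_dvd hmon').2 (dvd_mul_right (X ^ (m * t) + 1) (Q.eval (X ^ m)))
  rw [← heval, add_modByMonic, hzero, add_zero]

/-- **GG §8.3, eq. (6): "nothing happens" in passing to `D`.**  The blocks have degree `< m`,
so the negacyclic convolution of the block sequences can be computed in
`D = R[x]/(x^{2m}+1)` and lifted back by the canonical representative of degree `< 2m`: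
`h_k = lift (nconv t (f_i mod x^{2m}+1) (g_j mod x^{2m}+1))_k`. [cite: GathenGerhard2013, §8.3 eq. (6)] -/
theorem nconv_block_eq_lift {m t : ℕ} (hm : 0 < m) (f g : R[X]) (k : ℕ) :
    nconv t (block m f) (block m g) k =
      AdjoinRoot.modByMonicHom (monic_X_pow_add_one (by omega : 0 < 2 * m))
        (nconv t (AdjoinRoot.mk (X ^ (2 * m) + 1) ∘ block m f)
          (AdjoinRoot.mk (X ^ (2 * m) + 1) ∘ block m g) k) := by
  rw [← map_nconv, AdjoinRoot.modByMonicHom_mk]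
  symm
  nontriviality R
  refine (modByMonic_eq_self_iff (monic_X_pow_add_one (by omega : 0 < 2 * m))).2
    (degree_lt_degree ?_)
  rw [natDegree_X_pow_add_one]
  have hb : ∀ (p : R[X]) (i : ℕ), (block m p i).natDegree ≤ m - 1 := fun p i =>
    Nat.le_sub_one_of_lt (natDegree_block_lt hm p i)
  have hprod : ∀ i j, (block m f i * block m g j).natDegree ≤ 2 * m - 2 := by
    intro i j
    refine natDegree_mul_le.trans ?_
    have := hb f i; have := hb g j; omega
  have hle : (nconv t (block m f) (block m g) k).natDegree ≤ 2 * m - 2 := by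
    unfold nconv
    refine (natDegree_sub_le _ _).trans (max_le ?_ ?_) <;>
      exact natDegree_sum_le_of_forall_le _ _ fun i _ => hprod _ _
  omega

/-- **Algorithm 8.20 with the convolution done in `D`** (steps 2–4, the multiplications in
`D` left abstract): `fg mod (x^{mt}+1) = (∑_{k<t} lift(nconv_D(f*, g*)_k) x^{mk}) mod (x^{mt}+1)`.
[cite: GathenGerhard2013, §8.3 Algorithm 8.20] -/
theorem mul_modByMonic_eq_of_blocks_adjoinRoot {m t : ℕ} (hm : 0 < m) (ht : 0 < t) {f g : R[X]}
    (hf : f.natDegree < m * t) (hg : g.natDegree < m * t) :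
    (f * g) %ₘ (X ^ (m * t) + 1) =
      (∑ k ∈ range t, AdjoinRoot.modByMonicHom (monic_X_pow_add_one (by omega : 0 < 2 * m))
        (nconv t (AdjoinRoot.mk (X ^ (2 * m) + 1) ∘ block m f)
          (AdjoinRoot.mk (X ^ (2 * m) + 1) ∘ block m g) k) * X ^ (m * k)) %ₘ (X ^ (m * t) + 1) := by
  rw [mul_modByMonic_eq_of_blocks hm ht hf hg]
  congr 1
  refine sum_congr rfl fun k _ => ?_
  rw [nconv_block_eq_lift hm f g k]

/-- In `D = R[x]/(x^{2m}+1)`, `x^{2m} = −1`. [folklore] -/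
theorem mk_X_pow_two_mul (m : ℕ) :
    (AdjoinRoot.mk (X ^ (2 * m) + 1 : R[X])) (X ^ (2 * m)) = -1 := by
  have h : (AdjoinRoot.mk (X ^ (2 * m) + 1 : R[X])) (X ^ (2 * m) + 1) = 0 := AdjoinRoot.mk_self
  rw [map_add, map_one] at h
  exact eq_neg_of_add_eq_zero_left h

/-- **Algorithm 8.20, steps 2–4, with the fast convolution of step 3** (GG Thm 8.22,
correctness): let `m > 0`, `t = 2^κ` with `t ∣ 2m`, `2·half = 1` in `R`,
`η = x^{2m/t} mod (x^{2m}+1) ∈ D` (a `2t`-th root of unity with `η^t = −1`) and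
`tinv = half^κ`.  Then for `deg f, deg g < mt`,
`fg mod (x^{mt}+1) = (∑_{k<t} lift(fastNconv κ η tinv f* g* k) · x^{mk}) mod (x^{mt}+1)`, where
`fastNconv` (three FFTs of length `t` over `D`, `t` pointwise products in `D`, unweighting) is
the function of `FastFourierTransform.lean` and `f*_i = f_i mod (x^{2m}+1)`.  The products in
`D` are negacyclic convolutions of length `2m` (`coeff_mul_modByMonic_eq_nconv`): the recursive
calls. [cite: GathenGerhard2013, §8.3 Algorithm 8.20 / Thm 8.22] -/
theorem mul_modByMonic_eq_schonhageStep {m κ : ℕ} (hm : 0 < m) (hdvd : 2 ^ κ ∣ 2 * m)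
    {half : R} (hhalf : 2 * half = 1) {f g : R[X]}
    (hf : f.natDegree < m * 2 ^ κ) (hg : g.natDegree < m * 2 ^ κ) :
    (f * g) %ₘ (X ^ (m * 2 ^ κ) + 1) =
      (∑ k ∈ range (2 ^ κ), AdjoinRoot.modByMonicHom (monic_X_pow_add_one (by omega : 0 < 2 * m))
        (fastNconv κ (AdjoinRoot.mk (X ^ (2 * m) + 1 : R[X]) (X ^ (2 * m / 2 ^ κ)))
          (AdjoinRoot.mk (X ^ (2 * m) + 1 : R[X]) (C (half ^ κ)))
          (AdjoinRoot.mk (X ^ (2 * m) + 1) ∘ block m f)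
          (AdjoinRoot.mk (X ^ (2 * m) + 1) ∘ block m g) k) * X ^ (m * k)) %ₘ
        (X ^ (m * 2 ^ κ) + 1) := by
  have ht : 0 < 2 ^ κ := by positivity
  rw [mul_modByMonic_eq_of_blocks_adjoinRoot hm ht hf hg]
  congr 1
  refine sum_congr rfl fun k hk => ?_
  congr 2
  symm
  refine fastNconv_eq_nconv ?_ ?_ _ _ (mem_range.1 hk)
  · rw [← map_pow, ← pow_mul, Nat.div_mul_cancel hdvd, mk_X_pow_two_mul]
  · have h1 : half ^ κ * ((2 ^ κ : ℕ) : R) = 1 := by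
      rw [Nat.cast_pow, Nat.cast_two, ← mul_pow, mul_comm, hhalf, one_pow]
    rw [← map_natCast (AdjoinRoot.mk (X ^ (2 * m) + 1 : R[X])), ← map_mul, ← C_eq_natCast,
      ← map_mul, h1, C_1, map_one]

end Literature.Computability.AlgebraicComplexity
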